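import Summits.KontsevichZagierPeriods.KontsevichZagierPeriods.Theorems.RootDecompWalshStrataConicDescent

/-!
# Conic descent, gen 6 (L4): one-variable EULER DESCENT WITH A RATIONAL FACTOR

Decomposition node `WalshStrata` (route `RootDecompWalshStrata`, support item `QuadricBakerDescent`,
stmt-KontsevichZagierPeriods-27597, after `quadricBakerDescent_two` ≡ its `d = 3` slice).  Gen 4 proved
SQUARE-ROOT DESCENT `[T, γ√(e x² + f x + g)] ∈ InBaker` for a CONSTANT rational factor `γ`
(`sqrtDescent_holds`).  The `d = 3` programme (gen 5 design: adapted atoms, fibrewise vertex charts,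
rule (3) in `z` then in `y`) terminates in one-variable representations
`[T, R(x)·√Δ(x)]` with a RATIONAL FUNCTION factor `R = P/Q ∈ ℚ(x)` and a rational quadratic `Δ`;
this file proves that terminal step inside KZ's rules (1)–(3) over `ℚ` — in closed form,
`InBaker.sqrt_rational` (every `R` regular on a compact hull of `T`, every non-degenerate `Δ`) —
through the following layers:

* `InBaker.linear_factor` — `Δ = f x + g`, `f ≠ 0`, ANY `R`: the chart `x = (t² − g)/f` is `ℚ`-rational.
* `InBaker.odd_factor` — `Δ = e x² + f x + g`, `e ≠ 0`, integrand `(x − x₀)·S((x − x₀)²)·√Δ`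
  (`x₀ = −f/(2e)` the vertex, `S ∈ ℚ(s)`): the composite chart `x = x₀ ± √((t² − h)/e)` (`t = √Δ`)
  is `ℚ`-semialgebraic and pulls the integrand back to `S((t² − h)/e)·t²/|e| ∈ ℚ(t)`.
* `InBaker.even_ellipse`, `InBaker.even_hyperbola_in`, `InBaker.even_hyperbola_out` — integrand
  `E((x − x₀)²)·√Δ` with `E ∈ ℚ(s)` and vertex value `h = g − f²/(4e) ≠ 0`: under each gen-4 vertex
  chart `x = x₀ + ρ₀·W(v)` only `ρ₀` is irrational and `ρ₀² ∈ ℚ`, so `(x − x₀)² = ρ₀²·W(v)² ∈ ℚ(v)`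
  and the pull-back is `ℚ`-rational (PARITY TRICK).
* `InBaker.even_factor` — dispatcher over the sign pattern of `(e, h)` (incl. the empty case
  `e < 0`, `h ≤ 0`).
* `Parity.identity` + `InBaker.euler_factor` — the GENERAL factor `R = P/Q`: the algebraic parity
  decomposition `R(x₀ + u) = (numE(u²) + u·numO(u²))/den₂(u²)` (`den₂(u²) = Q(x₀+u)·Q(x₀−u)`,
  explicit via `Polynomial.contract 2` / `divX`) + rule (1b) reduce to the two previous cases
  WHENEVER neither `Q` nor its mirror `Q(2x₀ − ·)` vanishes on a compact hull `[a, b] ⊇ T` (then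
  the even part is bounded, hence separately integrable: `bddRep`).
* `InBaker.of_invert'` + `InBaker.mirror_atom` — the configuration the parity split cannot treat,
  a pole `a ∈ ℚ` of `R` whose mirror `2x₀ − a` meets the hull of `T`, is resolved at the level of
  its atom `c·√D/((x − a)·D(x))` (`D(a) ≠ 0`) on ANY domain by a NEW chart, the INVERSION
  `x = a + 1/z`: it carries the atom to the even factor `(±c/D̃)·√D̃` of the inverted conic
  `D̃(z) = D(a)z² + D′(a)z + e` (same `h` up to the factor `e/D(a)`), and `even_factor` finishes.
  (Partial fractions: `c/(x − a) = c(e(x − a) + D′(a))/D + c·D(a)/((x − a)D)`.)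

* `InBaker.root_pole_atom` — the companion atom `c·√D/(x − b)` at a rational ROOT `b` of `D`
  (the only place where a pole of `R` may touch the closure of `T ∩ {D > 0}`, order `−1/2`), on
  ANY domain: inversion about the root makes the radicand LINEAR, `z²·D(b + 1/z) = D′(b)z + e`,
  and `linear_factor` finishes.  So EVERY simple rational pole of `R` is settled at atom level.
* `InBaker.sqrt_const_pole`, `InBaker.sqrt_const_dpole`, `InBaker.sqrt_const` — the degenerate
  ("scaled") strata `[T, √m·S(x)]`, `0 < m ∈ ℚ` (from `h = 0 < e ∉ ℚ²` and `e = f = 0 < g ∉ ℚ²`):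
  the atoms `c√m/(x − a)`, `c√m/(x − a)²`, `c√m` on ANY domain by `ℚ`-SEMIALGEBRAIC CHARTS WITH
  IRRATIONAL COEFFICIENTS — the Möbius map `x = a + (t + √m)/(t − √m)` (pull-back `2cm/(t² − m)`),
  `x = a + √m/s` and `x = s/√m` (pull-backs constant).

* `integrableOn_div_sqrt_qD`, `sqrtDivRep`, `InBaker.inv_sqrt_factor` (§24.10–24.11) — the order
  `−1/2` singularities: `F/√D` with `F` bounded `ℚ`-semialgebraic on a bounded `T ⊆ {D > 0}` is
  integrable (primitive `2√D/D′` near each root, `|D′| ≥ √Δ/2` there), so `[T, F/√D]` IS a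
  representation and `[T, N(x)·√D/D] ∈ InBaker` for every polynomial `N` (rule (1b) down to
  `sqrtDescent_holds` and `even_factor`); `InBaker.simple_pole`, `InBaker.poly_factor`,
  `InBaker.rat_factor`, `InBaker.pole_pow`, `InBaker.rat_factor_mult` (§24.11–24.14) — the
  BOOKKEEPING: every `R = N/(Q₀·∏(x − aᵢ)^{kᵢ})` with rational poles `aᵢ` of any multiplicity at
  positive distance from `T` (and `Q₀` clean in the sense of `euler_factor`), by partial fractions
  (`pf_step`, induction on the pole list) + the atoms + inversion `x = a + 1/z` for `kᵢ ≥ 2`.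
* `InBaker.moebius_factor'`, `moebius_mirror_eq`, `moebius_mirror_root`, `exists_moebius_centre`,
  `InBaker.of_grid`, `InBaker.euler_full` (§24.15–24.17) — IRRATIONAL poles in mirror position are
  NOT an obstruction: the inversion `x = a + 1/z` (`a ∈ ℚ` left of the hull) transports
  `N/Q·√D` to `Ñ/Q̃·√D̃` with `Q̃ = reverse Taylor expansion of Q at a` and conjugates the
  `z`-vertex mirror to the `ℚ`-involution `μ_a` of the conic (`moebius_mirror_eq`); `μ_a(θ) = θ'`
  exactly at the roots of `D` (`moebius_mirror_root`), so for `Q` prime to `D` the bad centres near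
  any point are finitely many (`exists_moebius_centre`), and a Lebesgue-number grid of rational
  cells (`of_grid`) gives **`euler_full`**: `[T, N/Q·√D] ∈ InBaker` whenever `Q ≠ 0` on a compact
  hull `[lo, hi] ⊇ T` and no real root of `Q` lies on `D = 0`.
* `InBaker.bezout_split` (§24.18) — coprime denominators split (`u Q₁ + w Q₂ = 1`; no degree control
  needed, integrability of the pieces from `sqrtDivRep` + compactness), and the CAPSTONE
  **`InBaker.sqrt_rational`**: for `e ≠ 0`, `h ≠ 0` and EVERY `R = N/Q ∈ ℚ(x)` with `Q ≠ 0` on a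
  compact rational hull `[lo, hi] ⊇ T`, `[T, R(x)·√(e x² + f x + g)] ∈ InBaker` — factor
  `Q = ∏(X − aᵢ)^{kᵢ} · D₁^m · Q₀` (`D₁ = eX² + fX + g`; `exists_eq_pow_mul_not_dvd`,
  `isCoprime_quad_of_not_dvd`, `qD_ne_zero_of_aeval_eq_zero`), split twice, and send the three parts
  to `rat_factor_mult`, `euler_factor` (the conic power is vertex-symmetric, `qD_reflect`) and
  `euler_full`.  This is lemma L4 of the lineage design in closed form.
* `InBaker.bezout_split'`, `qD_eq_mul_of_root`, **`InBaker.sqrt_rational_div`** (§24.19) — the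
  companion for DIVISION by `√D`: `[T, R(x)/√(e x² + f x + g)] ∈ InBaker` for every `R = N/Q` with
  `Q ≠ 0` on a compact hull of `T`, with NO condition on the roots of `D` — the closure of
  `T ⊆ {D > 0}` may meet them (order `−1/2` blow-up; these are the terminal integrands `F(x)/√D` of
  the fibrewise vertex charts).  `R/√D = (R/D)·√D`; when `D` vanishes on the hull, `D₁ ∤ Q` and a
  Bézout split whose second factor need only be non-zero ON THE DOMAIN separates the hull-clean part
  (`sqrt_rational`) from `N/√D` (`inv_sqrt_factor`, `D₁` irreducible) or from root poles
  `N·√D/∏(x − θ)` (`rat_factor_mult` on any domain, rational roots).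
Together the two capstones cover every integrable `R(x)·√D^{±1}` on a bounded `T` after cancelling
common factors of `N` and `Q` (a pole of `R` on the closure of `T ⊆ {D > 0}` can only sit at a root
of `D`, where `R·√D = (R·D)/√D` moves it to the numerator side).
* `InBaker.sqrt_const_even` (§24.20) — the scaled strata with an EVEN factor, `[T, √m·E(x²)]`,
  `E = N/Q ∈ ℚ(s)`, `Q(x²) ≠ 0` on `T`, on ANY domain: the chart `x = s/√m` pulls it back to the
  `ℚ`-rational `E(s²/m)` (the vertical-edge terms `(2γH(x_c)/√(−d₂))·(1 − v²)²/(1 + v²)³` of the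
  two-variable ellipse-type descent are of this form).

What is NOT claimed here (recorded in the node as typed targets): (i) the scaled strata
`[T, √m·S(x)]` with `S` NOT even (beyond the atoms of §24.7/24.9: odd parts `√m·x·E(x²)` with poles
of order ≥ 3, polynomial parts, irreducible denominators); (ii) the degenerate radicands `h = 0`
(`√D = √e·|x − x₀|`, which is case (i) when `e ∉ ℚ²`) — `e = 0` is `linear_factor`; (iii) the
two-variable fibre descent (lineage L3/L5–L7) that produces these one-variable representations from
the `d = 3` cells.

All statements are over the landed gen-4 API (`InBaker`, `exists_cov₁`, `qD`, `qD_eq_vertex`, …;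
`Theorems/RootDecompWalshStrataConic*.lean`); 0 sorry; std axioms.
[KontsevichZagier2001 §1.1–1.2; BCR1998 §2.2; Euler 1768 (Institutiones calculi integralis I,
"substitutiones Euleri"); this node gen 4 `sqrtDescent_*`]

This is part 1/12 of the gen-6 package (the farm-checked monolith `EulerDescent.lean` cut at declaration
boundaries into ≤ 400-line files); the parts, in import order: `EulerDescent01` … `EulerDescent12`.
-/

noncomputable section

open Literature.NumberTheory.Transcendental
open MeasureTheory Set
open MvPolynomial (aeval)
open Literature.ModelTheory.ExponentialFields (IsSemialgebraic isSemialgebraic_univ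
  isSemialgebraic_setOf_eval_pos isSemialgebraic_setOf_eval_lt isSemialgebraic_setOf_eval_le
  isSemialgebraic_setOf_eval_nonneg isSemialgebraic_setOf_eval_eq_zero continuous_aeval_real
  tarski_seidenberg_real_holds)

namespace Summit.KontsevichZagierPeriods.RootDecompWalshStrata.ConicDescent

/-! #### 24.1 Preliminaries: rational functions on a chart domain, generic rule-(2)/(1a) helpers -/

/-- `F` is a RATIONAL FUNCTION OVER `ℚ` on `T ⊆ ℝ¹`: it agrees on `T` with a quotient `p/q` of
polynomials with rational coefficients whose denominator does not vanish on `T`.  This is exactly the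
integrand clause of `KZ.IntegralRep.IsRational` in dimension one, made composable (a definition, not a
fact: a `Set` of functions used applicatively, `IsRatOn T F`, like `InBaker`). [KontsevichZagier2001 §1.1] -/
def IsRatOn (T : Set (Fin 1 → ℝ)) : Set ((Fin 1 → ℝ) → ℝ) :=
  {F | ∃ p q : MvPolynomial (Fin 1) ℚ, (∀ v ∈ T, aeval v q ≠ 0) ∧ ∀ v ∈ T, F v = aeval v p / aeval v q}

namespace IsRatOn

variable {T S : Set (Fin 1 → ℝ)} {F G : (Fin 1 → ℝ) → ℝ}

/-- A quotient of polynomials is a rational function where the denominator does not vanish. -/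
theorem of_aeval_div (p q : MvPolynomial (Fin 1) ℚ) (hq : ∀ v ∈ T, aeval v q ≠ 0) :
    IsRatOn T fun v => aeval v p / aeval v q :=
  ⟨p, q, hq, fun _ _ => rfl⟩

/-- A polynomial is a rational function. -/
theorem of_aeval (p : MvPolynomial (Fin 1) ℚ) : IsRatOn T fun v => aeval v p :=
  ⟨p, 1, fun _ _ => by simp, fun _ _ => by simp⟩

/-- A rational constant is a rational function. -/
theorem const (c : ℚ) : IsRatOn T fun _ => (c : ℝ) :=
  (of_aeval (MvPolynomial.C c)).imp fun p ⟨q, hq, h⟩ => ⟨q, hq, fun v hv => by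
    rw [← h v hv]; simp⟩

/-- The coordinate is a rational function. -/
theorem coord : IsRatOn T fun v => v 0 :=
  (of_aeval (MvPolynomial.X 0)).imp fun p ⟨q, hq, h⟩ => ⟨q, hq, fun v hv => by
    rw [← h v hv]; simp⟩

/-- Rational functions are stable under pointwise agreement on `T`. -/
theorem congr (hF : IsRatOn T F) (h : ∀ v ∈ T, F v = G v) : IsRatOn T G := by
  obtain ⟨p, q, hq, hF⟩ := hF
  exact ⟨p, q, hq, fun v hv => by rw [← h v hv, hF v hv]⟩

/-- Rational functions restrict. -/
theorem mono (hF : IsRatOn T F) (hST : S ⊆ T) : IsRatOn S F := by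
  obtain ⟨p, q, hq, hF⟩ := hF
  exact ⟨p, q, fun v hv => hq v (hST hv), fun v hv => hF v (hST hv)⟩

/-- Sum of rational functions. -/
theorem add (hF : IsRatOn T F) (hG : IsRatOn T G) : IsRatOn T fun v => F v + G v := by
  obtain ⟨p, q, hq, hF⟩ := hF
  obtain ⟨p', q', hq', hG⟩ := hG
  refine ⟨p * q' + p' * q, q * q', fun v hv => by
    rw [map_mul]; exact mul_ne_zero (hq v hv) (hq' v hv), fun v hv => ?_⟩
  dsimp only
  rw [hF v hv, hG v hv, map_add, map_mul, map_mul, map_mul,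
    div_add_div _ _ (hq v hv) (hq' v hv)]
  ring

/-- Product of rational functions. -/
theorem mul (hF : IsRatOn T F) (hG : IsRatOn T G) : IsRatOn T fun v => F v * G v := by
  obtain ⟨p, q, hq, hF⟩ := hF
  obtain ⟨p', q', hq', hG⟩ := hG
  refine ⟨p * p', q * q', fun v hv => by
    rw [map_mul]; exact mul_ne_zero (hq v hv) (hq' v hv), fun v hv => ?_⟩
  dsimp only
  rw [hF v hv, hG v hv, map_mul, map_mul, div_mul_div_comm]

/-- Negative of a rational function. -/
theorem neg (hF : IsRatOn T F) : IsRatOn T fun v => -F v :=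
  ((const (-1)).mul hF).congr fun v _ => by push_cast; ring

/-- Difference of rational functions. -/
theorem sub (hF : IsRatOn T F) (hG : IsRatOn T G) : IsRatOn T fun v => F v - G v :=
  (hF.add hG.neg).congr fun v _ => by ring

/-- Powers of a rational function. -/
theorem pow (hF : IsRatOn T F) (n : ℕ) : IsRatOn T fun v => F v ^ n := by
  induction n with
  | zero => exact (const 1).congr fun v _ => by simp
  | succ n ih => exact (ih.mul hF).congr fun v _ => by rw [pow_succ]

/-- Inverse of a rational function that does not vanish on `T`. -/
theorem inv (hF : IsRatOn T F) (h0 : ∀ v ∈ T, F v ≠ 0) : IsRatOn T fun v => (F v)⁻¹ := by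
  obtain ⟨p, q, hq, hF⟩ := hF
  refine ⟨q, p, fun v hv hp => h0 v hv (by rw [hF v hv, hp, zero_div]), fun v hv => ?_⟩
  dsimp only
  rw [hF v hv, inv_div]

/-- Quotient of rational functions, the denominator non-vanishing on `T`. -/
theorem div (hF : IsRatOn T F) (hG : IsRatOn T G) (h0 : ∀ v ∈ T, G v ≠ 0) :
    IsRatOn T fun v => F v / G v :=
  (hF.mul (hG.inv h0)).congr fun v _ => by rw [div_eq_mul_inv]

/-- A ONE-VARIABLE POLYNOMIAL OVER `ℚ` OF A RATIONAL FUNCTION is a rational function (composition;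
the engine of the parity trick). -/
theorem polyAeval (P : Polynomial ℚ) (hF : IsRatOn T F) :
    IsRatOn T fun v => Polynomial.aeval (F v) P := by
  induction P using Polynomial.induction_on' with
  | add p q hp hq => exact (hp.add hq).congr fun v _ => by rw [map_add]
  | monomial n c =>
    exact ((const c).mul (hF.pow n)).congr fun v _ => by
      rw [Polynomial.aeval_monomial]; rfl

/-- A rational function on a `ℚ`-semialgebraic set is a `ℚ`-semialgebraic function. [BCR1998 §2.2] -/
theorem isSemialgebraicFunOn (hT : IsSemialgebraic ℚ T) (hF : IsRatOn T F) :
    IsSemialgebraicFunOn ℚ T F := by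
  obtain ⟨p, q, hq, hF⟩ := hF
  exact (isSemialgebraicFunOn_aeval_div_aeval hT p q hq).congr fun v hv => (hF v hv).symm

/-- The non-vanishing locus of a rational function inside a `ℚ`-semialgebraic set is
`ℚ`-semialgebraic. [BCR1998 §2.2] -/
theorem isSemialgebraic_sep_ne_zero (hT : IsSemialgebraic ℚ T) (hF : IsRatOn T F) :
    IsSemialgebraic ℚ {v | v ∈ T ∧ F v ≠ 0} := by
  have h := hF.isSemialgebraicFunOn hT
  convert IsSemialgebraicFunOn.isSemialgebraic_sep_pos (IsSemialgebraicFunOn.mul_holds h h) using 1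
  ext v
  simp only [mem_setOf_eq, Pi.mul_apply]
  exact and_congr_right fun _ => by
    constructor
    · intro h0; exact mul_self_pos.2 h0
    · intro h0 hF0; rw [hF0, mul_zero] at h0; exact lt_irrefl _ h0

end IsRatOn

/-- `InBaker` form of `exists_cov₁` with a RATIONAL-FUNCTION pull-back given as `IsRatOn` data. -/
theorem InBaker.of_cov₁_rat (r' : KZ.IntegralRep 1) {T₀ : Set (Fin 1 → ℝ)}
    (hT₀ : IsSemialgebraic ℚ T₀) (g g' : ℝ → ℝ) (hg : IsSemialgebraicFunOn ℚ T₀ fun v => g (v 0))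
    (hder : ∀ v ∈ T₀, HasDerivAt g (g' (v 0)) (v 0))
    (hinj : ∀ s ∈ T₀, ∀ t ∈ T₀, g (s 0) = g (t 0) → s 0 = t 0)
    (hsurj : ∀ x ∈ r'.domain, ∃ v ∈ T₀, g (v 0) = x 0) (R : (Fin 1 → ℝ) → ℝ) (hR : IsRatOn T₀ R)
    (hRe : ∀ v ∈ T₀, lift₁ g v ∈ r'.domain → R v = r'.integrand (lift₁ g v) * |g' (v 0)|) :
    InBaker (KZ.of r') := by
  obtain ⟨p, q, hq, hpq⟩ := hR
  exact InBaker.of_cov₁ r' hT₀ g g' hg hder hinj hsurj p q hq fun v hv hvd => by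
    rw [← hpq v hv]; exact hRe v hv hvd

/-- Callback form of `exists_cov₁`: to put `[r']` in the Baker sector it suffices to do so for the
pulled-back representation along a scalar chart. [KontsevichZagier2001 §1.2 rule (2)] -/
theorem InBaker.of_cov₁' (r' : KZ.IntegralRep 1) {T₀ : Set (Fin 1 → ℝ)}
    (hT₀ : IsSemialgebraic ℚ T₀) (g g' : ℝ → ℝ) (hg : IsSemialgebraicFunOn ℚ T₀ fun v => g (v 0))
    (hder : ∀ v ∈ T₀, HasDerivAt g (g' (v 0)) (v 0))
    (hinj : ∀ s ∈ T₀, ∀ t ∈ T₀, g (s 0) = g (t 0) → s 0 = t 0)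
    (hsurj : ∀ x ∈ r'.domain, ∃ v ∈ T₀, g (v 0) = x 0) (R : (Fin 1 → ℝ) → ℝ)
    (hR : IsSemialgebraicFunOn ℚ T₀ R)
    (hRe : ∀ v ∈ T₀, lift₁ g v ∈ r'.domain → R v = r'.integrand (lift₁ g v) * |g' (v 0)|)
    (h : ∀ r : KZ.IntegralRep 1, r.domain = {v | v ∈ T₀ ∧ lift₁ g v ∈ r'.domain} →
      r.integrand = R → InBaker (KZ.of r)) :
    InBaker (KZ.of r') := by
  obtain ⟨r, hrd, hri, hrel⟩ := exists_cov₁ r' hT₀ g g' hg hder hinj hsurj R hR hRe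
  refine (h r hrd hri).congr ?_
  have : KZ.of r' - KZ.of r = -(KZ.of r - KZ.of r') := by abel
  rw [this]
  exact KZ.relations.neg_mem hrel

/-- REFLECTION `x = c − t` about a rational point `c/2` (rule (2), `|det| = 1`), callback form: the
reflected representation has domain the mirror image and integrand `t ↦ f(c − t)`.
[KontsevichZagier2001 §1.2 rule (2)] -/
theorem InBaker.of_reflect' (c : ℚ) (r' : KZ.IntegralRep 1) {T₀ : Set (Fin 1 → ℝ)}
    (hT₀ : IsSemialgebraic ℚ T₀) (hcov : ∀ x ∈ r'.domain, (fun _ : Fin 1 => (c : ℝ) - x 0) ∈ T₀)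
    (R : (Fin 1 → ℝ) → ℝ) (hR : IsSemialgebraicFunOn ℚ T₀ R)
    (hRe : ∀ v ∈ T₀, (fun _ : Fin 1 => (c : ℝ) - v 0) ∈ r'.domain →
      R v = r'.integrand (fun _ : Fin 1 => (c : ℝ) - v 0))
    (h : ∀ r : KZ.IntegralRep 1,
      r.domain = {v | v ∈ T₀ ∧ (fun _ : Fin 1 => (c : ℝ) - v 0) ∈ r'.domain} →
      r.integrand = R → InBaker (KZ.of r)) :
    InBaker (KZ.of r') := by
  have hgS : IsSemialgebraicFunOn ℚ T₀ fun v => (c : ℝ) - v 0 :=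
    ((isSemialgebraicFunOn_ratCast hT₀ c).sub_holds (isSemialgebraicFunOn_apply hT₀ 0)).congr
      fun v _ => by simp only [Pi.sub_apply]
  have hlift : ∀ v : Fin 1 → ℝ, lift₁ (fun t : ℝ => (c : ℝ) - t) v = fun _ => (c : ℝ) - v 0 :=
    fun v => rfl
  refine InBaker.of_cov₁' r' hT₀ (fun t : ℝ => (c : ℝ) - t) (fun _ => -1) hgS
    (fun v _ => by simpa using (hasDerivAt_id (v 0)).const_sub (c : ℝ))
    (fun s _ t _ hst => by linarith)
    (fun x hx => ⟨fun _ => (c : ℝ) - x 0, hcov x hx, by simp⟩) R hR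
    (fun v hv hvd => by
      rw [hlift] at hvd
      rw [hlift, hRe v hv hvd, abs_neg, abs_one, mul_one])
    fun r hrd hri => h r (by simp only [hrd, hlift]) hri

/-- SPLIT AT A RATIONAL POINT `c` (rule (1a); the point `{c}` itself is null): `InBaker [r]` follows
from `InBaker` of the two restrictions to `{x > c}` and `{x < c}`, callback form.
[KontsevichZagier2001 §1.2 rule (1)] -/
theorem InBaker.of_split_at (c : ℚ) (r : KZ.IntegralRep 1)
    (hright : ∀ r₁ : KZ.IntegralRep 1, r₁.domain = {v | v ∈ r.domain ∧ (c : ℝ) < v 0} →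
      r₁.integrand = r.integrand → InBaker (KZ.of r₁))
    (hleft : ∀ r₁ : KZ.IntegralRep 1, r₁.domain = {v | v ∈ r.domain ∧ v 0 < (c : ℝ)} →
      r₁.integrand = r.integrand → InBaker (KZ.of r₁)) :
    InBaker (KZ.of r) := by
  have hsa : ∀ (s : Set (Fin 1 → ℝ)), IsSemialgebraic ℚ s →
      IsSemialgebraic ℚ {v | v ∈ s ∧ (c : ℝ) < v 0} := fun s hs => by
    convert IsSemialgebraicFunOn.isSemialgebraic_sep_pos
      ((isSemialgebraicFunOn_apply hs 0).sub_holds (isSemialgebraicFunOn_ratCast hs c)) using 1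
    ext v; simp only [mem_setOf_eq, Pi.sub_apply, sub_pos]
  have hsb : ∀ (s : Set (Fin 1 → ℝ)), IsSemialgebraic ℚ s →
      IsSemialgebraic ℚ {v | v ∈ s ∧ v 0 < (c : ℝ)} := fun s hs => by
    convert IsSemialgebraicFunOn.isSemialgebraic_sep_pos
      ((isSemialgebraicFunOn_ratCast hs c).sub_holds (isSemialgebraicFunOn_apply hs 0)) using 1
    ext v; simp only [mem_setOf_eq, Pi.sub_apply, sub_pos]
  have hsm : ∀ (s : Set (Fin 1 → ℝ)), IsSemialgebraic ℚ s →
      IsSemialgebraic ℚ {v | v ∈ s ∧ v 0 ≤ (c : ℝ)} := fun s hs => by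
    convert IsSemialgebraicFunOn.isSemialgebraic_sep_nonneg
      ((isSemialgebraicFunOn_ratCast hs c).sub_holds (isSemialgebraicFunOn_apply hs 0)) using 1
    ext v; simp only [mem_setOf_eq, Pi.sub_apply, sub_nonneg]
  set A : Set (Fin 1 → ℝ) := {v | v ∈ r.domain ∧ (c : ℝ) < v 0} with hAdef
  set M : Set (Fin 1 → ℝ) := {v | v ∈ r.domain ∧ v 0 ≤ (c : ℝ)} with hMdef
  have hA := hsa _ r.isSemialgebraic_domain
  have hM := hsm _ r.isSemialgebraic_domain
  have hAr : A ⊆ r.domain := fun v hv => hv.1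
  have hMr : M ⊆ r.domain := fun v hv => hv.1
  refine InBaker.of_split r hA hM hAr hMr ?_ ?_ (hright _ rfl rfl) ?_
  · ext v
    simp only [mem_union, mem_setOf_eq]
    constructor
    · intro hv
      rcases lt_or_ge (c : ℝ) (v 0) with h | h
      · exact Or.inl ⟨hv, h⟩
      · exact Or.inr ⟨hv, h⟩
    · rintro (⟨hv, _⟩ | ⟨hv, _⟩) <;> exact hv
  · have : A ∩ M = ∅ := by
      ext v
      simp only [hAdef, hMdef, mem_inter_iff, mem_setOf_eq, mem_empty_iff_false, iff_false]
      rintro ⟨⟨_, h1⟩, _, h2⟩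
      exact absurd h1 (not_lt.2 h2)
    rw [this, measure_empty]
  · -- `M = B ∪ Z`, `Z ⊆ {c}` null
    set rM := r.restrict M hM hMr with hrMdef
    set B : Set (Fin 1 → ℝ) := {v | v ∈ r.domain ∧ v 0 < (c : ℝ)} with hBdef
    set Z : Set (Fin 1 → ℝ) := {v | v ∈ M ∧ 0 ≤ v 0 - (c : ℝ)} with hZdef
    have hB := hsb _ r.isSemialgebraic_domain
    have hZ : IsSemialgebraic ℚ Z := by
      convert IsSemialgebraicFunOn.isSemialgebraic_sep_nonneg
        ((isSemialgebraicFunOn_apply hM 0).sub_holds (isSemialgebraicFunOn_ratCast hM c)) using 1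
      ext v; simp only [hZdef, hMdef, mem_setOf_eq, Pi.sub_apply]
    have hBM : B ⊆ rM.domain := fun v hv => ⟨hv.1, hv.2.le⟩
    have hZM : Z ⊆ rM.domain := fun v hv => hv.1
    have hZsub : Z.Subsingleton := by
      intro s hs t ht
      funext j
      fin_cases j
      have h1 : s 0 ≤ (c : ℝ) := hs.1.2
      have h1' : 0 ≤ s 0 - (c : ℝ) := hs.2
      have h2 : t 0 ≤ (c : ℝ) := ht.1.2
      have h2' : 0 ≤ t 0 - (c : ℝ) := ht.2
      change s 0 = t 0
      linarith
    refine InBaker.of_split rM hB hZ hBM hZM ?_ ?_ (hleft _ rfl rfl) ?_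
    · ext v
      simp only [hZdef, hMdef, KZ.IntegralRep.domain_restrict, mem_union, mem_setOf_eq, hrMdef]
      constructor
      · rintro ⟨hv, hle⟩
        rcases hle.lt_or_eq with h | h
        · exact Or.inl ⟨hv, h⟩
        · exact Or.inr ⟨⟨hv, hle⟩, by rw [h, sub_self]⟩
      · rintro (⟨hv, h⟩ | ⟨⟨hv, h⟩, _⟩)
        · exact ⟨hv, h.le⟩
        · exact ⟨hv, h⟩
    · exact measure_mono_null inter_subset_right (hZsub.measure_zero _)
    · exact InBaker.of_mem_relations
        (KZ.of_mem_relations_of_volume_eq_zero _ (hZsub.measure_zero _))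

end Summit.KontsevichZagierPeriods.RootDecompWalshStrata.ConicDescent
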